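import Literature.NumberTheory.Automorphic.LocalNormOneHilbert90
import Literature.NumberTheory.Automorphic.TorusCharacterRigidityCofinite
import Literature.NumberTheory.Rogawski1990.OneDimAutRepH
import HarnessLib

/-!
# A one-dimensional automorphic `ξ = (η, ψ)` of `H = U(2) × U(1)` is determined by its local characters `ξ_v` at ALL BUT FINITELY MANY places
# (strong multiplicity one for the characters of `H`; Rogawski 1990 §13.1 p. 199, §12.2 p. 174; Cassels–Fröhlich Ch. VII §4 Prop. 4.1)

Topic `NumberTheory/Rogawski1990`; namespace `Literature.NumberTheory.Rogawski1990.OneDimAutRepH`.  PROOF FILE (theorems only; no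
definition, no named fact, no instance, no notation, no `sorry`); companion of ★ `OneDimAutRepHSplitRigidity` (rigidity from the labels at
ALL split places).  CM frame of ★ `OneDimAutRepH` ∕ ★ `XiLocalCharacter`: `ξ = (η, ψ)` a pair of automorphic characters of `T(𝔸_{L⁺}) =
U(1)_{L/L⁺}(𝔸)`, and the local character `ξ_v : H_v = U(Φ₂)(L⁺_v) × U(Φ₁)(L⁺_v) →* ℂˣ`, `ξ_v (h₀, u) = η_v (det h₀) · ψ_v (det h₀ · det u)`
(★ `xiLocalChar_apply_eq`).

* §1 **`ξ_v` determines `(η_v, ψ_v)`** (`torusLocalComponent_ψ_eq_of_xiLocalChar_eq`, `torusLocalComponent_η_eq_of_xiLocalChar_eq`): `det` is onto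
  the local norm-one torus on `U(Φ₁)` and on `U(Φ₂)` (★ `localDet_one_surjective`, ★ `localDet_two_surjective` — local Hilbert 90), so
  `ξ_v (1, u) = ψ_v (det u)` recovers `ψ_v` and then `ξ_v (h₀, 1) = η_v (det h₀) ψ_v (det h₀)` recovers `η_v`.
* §2 **`ξ = ξ′` from `ξ_v = ξ′_v` for all `v ∉ S₀`** (`ext_of_xiLocalChar_eq_of_not_mem`): by §1 the automorphic characters `η, η′` (and `ψ, ψ′`)
  have equal local components off `S₀`, hence are equal (★ `torusCharacter_eq_of_torusLocalComponent_eq_of_not_mem`: Tate's density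
  `K^× 𝕀_K^S` dense + idelic Hilbert 90), and `ξ = ξ′` (★ `OneDimAutRepH.ext`).
USE (crux H413 line LH7, (PK-A-H)): the «strong multiplicity one for characters» input `hglobH` of ★ `F0P3SpectralPacketRigidityReductionH.xiRigidityH_of_fibre`
for a character-indexed discreteness predicate: two character packets `{⟦ξ_v⟧}`, `{⟦ξ′_v⟧}` equal off a finite set come from the same `ξ` (with ★
`IrrClass.mk_ofChar_eq_mk_ofChar_iff`).

## References
* J. Rogawski, *Automorphic Representations of Unitary Groups in Three Variables* (1990), §13.1 p. 199 (`Π(ξ)` indexed by `ξ`), §12.2 p. 174,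
  §13.3 p. 202 (`ξ(h) = η(det₀ h) ψ(det h)`) [Rogawski1990].
* J. W. S. Cassels, A. Fröhlich (eds.), *Algebraic Number Theory* (1967), Ch. VII (Tate) §4 Prop. 4.1, §7.4 Cor. (a) [CasselsFrohlichANT1967].
-/

set_option autoImplicit false

noncomputable section

open NumberField IsDedekindDomain
open Literature.NumberTheory.Automorphic Literature.NumberTheory.Automorphic.UnitaryGroup

namespace Literature.NumberTheory.Rogawski1990

namespace OneDimAutRepH

variable {L : Type} [Field L] [NumberField L] [IsCMField L]

/-! ## §1 `ξ_v` determines `(η_v, ψ_v)` -/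

/-- **`ξ_v = ξ′_v ⇒ ψ_v = ψ′_v`**: evaluate at `(1, u)` with `det u = t` (★ `localDet_one_surjective`): `ξ_v (1, u) = ψ_v (t)`.
[cite: Rogawski1990, §13.3 p. 202; §12.2 p. 174] -/
theorem torusLocalComponent_ψ_eq_of_xiLocalChar_eq {ξ ξ' : OneDimAutRepH L} {v : HeightOneSpectrum (𝓞 ↥(maximalRealSubfield L))}
    (h : ξ.xiLocalChar v = ξ'.xiLocalChar v) :
    torusLocalComponent L (IsCMField.complexConj L) v ξ.ψ = torusLocalComponent L (IsCMField.complexConj L) v ξ'.ψ := by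
  refine MonoidHom.ext fun t => ?_
  obtain ⟨u, hu⟩ := localDet_one_surjective L v t
  have key := DFunLike.congr_fun h (1, u)
  erw [xiLocalChar_apply_eq, xiLocalChar_apply_eq] at key
  change torusLocalComponent L (IsCMField.complexConj L) v ξ.η (localDet (IsCMField.complexConj L) v (isUnit_antidiagOne_det L 2) 1) *
      torusLocalComponent L (IsCMField.complexConj L) v ξ.ψ
        (localDet (IsCMField.complexConj L) v (isUnit_antidiagOne_det L 2) 1 * localDet (IsCMField.complexConj L) v (isUnit_antidiagOne_det L 1) u) =
    torusLocalComponent L (IsCMField.complexConj L) v ξ'.η (localDet (IsCMField.complexConj L) v (isUnit_antidiagOne_det L 2) 1) *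
      torusLocalComponent L (IsCMField.complexConj L) v ξ'.ψ
        (localDet (IsCMField.complexConj L) v (isUnit_antidiagOne_det L 2) 1 * localDet (IsCMField.complexConj L) v (isUnit_antidiagOne_det L 1) u) at key
  rw [map_one, map_one, map_one, one_mul, one_mul, one_mul, hu] at key
  exact key

/-- **`ξ_v = ξ′_v ⇒ η_v = η′_v`**: evaluate at `(h₀, 1)` with `det h₀ = t` (★ `localDet_two_surjective`, local Hilbert 90): `ξ_v (h₀, 1) = η_v (t) ψ_v (t)`, and
cancel `ψ_v (t) = ψ′_v (t)`. [cite: Rogawski1990, §13.3 p. 202; §12.2 p. 174] [cite: CasselsFrohlichANT1967, Ch. VII §7.4 Cor. (a)] -/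
theorem torusLocalComponent_η_eq_of_xiLocalChar_eq {ξ ξ' : OneDimAutRepH L} {v : HeightOneSpectrum (𝓞 ↥(maximalRealSubfield L))}
    (h : ξ.xiLocalChar v = ξ'.xiLocalChar v) :
    torusLocalComponent L (IsCMField.complexConj L) v ξ.η = torusLocalComponent L (IsCMField.complexConj L) v ξ'.η := by
  have hψ := torusLocalComponent_ψ_eq_of_xiLocalChar_eq h
  refine MonoidHom.ext fun t => ?_
  obtain ⟨h₀, hh₀⟩ := localDet_two_surjective L v t
  have key := DFunLike.congr_fun h (h₀, 1)
  erw [xiLocalChar_apply_eq, xiLocalChar_apply_eq] at key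
  change torusLocalComponent L (IsCMField.complexConj L) v ξ.η (localDet (IsCMField.complexConj L) v (isUnit_antidiagOne_det L 2) h₀) *
      torusLocalComponent L (IsCMField.complexConj L) v ξ.ψ
        (localDet (IsCMField.complexConj L) v (isUnit_antidiagOne_det L 2) h₀ * localDet (IsCMField.complexConj L) v (isUnit_antidiagOne_det L 1) 1) =
    torusLocalComponent L (IsCMField.complexConj L) v ξ'.η (localDet (IsCMField.complexConj L) v (isUnit_antidiagOne_det L 2) h₀) *
      torusLocalComponent L (IsCMField.complexConj L) v ξ'.ψ
        (localDet (IsCMField.complexConj L) v (isUnit_antidiagOne_det L 2) h₀ * localDet (IsCMField.complexConj L) v (isUnit_antidiagOne_det L 1) 1) at key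
  rw [map_one, mul_one, hh₀, hψ] at key
  exact mul_right_cancel key

/-! ## §2 `ξ` is determined by `ξ_v` off a finite set of places -/

/-- **STRONG MULTIPLICITY ONE FOR THE CHARACTERS OF `H`**: two one-dimensional automorphic `ξ, ξ′` of `H = U(2) × U(1)` with the same local character
`ξ_v = ξ′_v` at every finite place `v` of `L⁺` outside a finite set `S₀` are EQUAL — §1 at every `v ∉ S₀`, then rigidity of automorphic characters of
the norm-one torus off a finite set (★ `torusCharacter_eq_of_torusLocalComponent_eq_of_not_mem`) for `η` and for `ψ`, then ★ `OneDimAutRepH.ext`.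
[cite: Rogawski1990, §13.1 p. 199; §12.2 p. 174] [cite: CasselsFrohlichANT1967, Ch. VII §4 Prop. 4.1 (proof)] -/
theorem ext_of_xiLocalChar_eq_of_not_mem {ξ ξ' : OneDimAutRepH L} (S₀ : Finset (HeightOneSpectrum (𝓞 ↥(maximalRealSubfield L))))
    (h : ∀ v : HeightOneSpectrum (𝓞 ↥(maximalRealSubfield L)), v ∉ S₀ → ξ.xiLocalChar v = ξ'.xiLocalChar v) : ξ = ξ' :=
  OneDimAutRepH.ext
    (torusCharacter_eq_of_torusLocalComponent_eq_of_not_mem (IsCMField.complexConj L) (Algebra.IsQuadraticExtension.finrank_eq_two _ L)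
      (IsCMField.complexConj_ne_one (K := L)) S₀ ξ.η ξ'.η ξ.hη ξ'.hη fun v hv => torusLocalComponent_η_eq_of_xiLocalChar_eq (h v hv))
    (torusCharacter_eq_of_torusLocalComponent_eq_of_not_mem (IsCMField.complexConj L) (Algebra.IsQuadraticExtension.finrank_eq_two _ L)
      (IsCMField.complexConj_ne_one (K := L)) S₀ ξ.ψ ξ'.ψ ξ.hψ ξ'.hψ fun v hv => torusLocalComponent_ψ_eq_of_xiLocalChar_eq (h v hv))

/-- **Cofinite form**: `ξ_v = ξ′_v` for almost all finite `v` ⇒ `ξ = ξ′`. [cite: Rogawski1990, §13.1 p. 199] [cite: CasselsFrohlichANT1967, Ch. VII §4 Prop. 4.1 (proof)] -/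
theorem ext_of_eventually_xiLocalChar_eq {ξ ξ' : OneDimAutRepH L}
    (h : ∀ᶠ v : HeightOneSpectrum (𝓞 ↥(maximalRealSubfield L)) in Filter.cofinite, ξ.xiLocalChar v = ξ'.xiLocalChar v) : ξ = ξ' := by
  have hfin : {v : HeightOneSpectrum (𝓞 ↥(maximalRealSubfield L)) | ¬ (ξ.xiLocalChar v = ξ'.xiLocalChar v)}.Finite :=
    Filter.eventually_cofinite.1 h
  exact ext_of_xiLocalChar_eq_of_not_mem hfin.toFinset fun v hv => by
    by_contra hne
    exact hv (hfin.mem_toFinset.2 hne)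

/-- **All places**: `ξ_v = ξ′_v` for every finite `v` ⇒ `ξ = ξ′` (the empty exceptional set). [cite: Rogawski1990, §13.1 p. 199] -/
theorem ext_of_xiLocalChar_eq {ξ ξ' : OneDimAutRepH L}
    (h : ∀ v : HeightOneSpectrum (𝓞 ↥(maximalRealSubfield L)), ξ.xiLocalChar v = ξ'.xiLocalChar v) : ξ = ξ' :=
  ext_of_xiLocalChar_eq_of_not_mem ∅ fun v _ => h v

/-- **The `Irr(H_v)`-class currency** (★ `GlobalPacketH.IsCharPacket` member sets `{⟦ξ_v⟧}`): if the classes `⟦ξ_v⟧ = ⟦ξ′_v⟧` agree at every finite place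
outside a finite set, then `ξ = ξ′` (★ `IrrClass.mk_ofChar_eq_mk_ofChar_iff` is applied by the consumer to pass from classes to characters; here the
hypothesis is already on characters).  Restated for the continuous-kernel data the packets carry. [cite: Rogawski1990, §12.1 p. 171; §13.1 p. 199] -/
theorem ext_of_forall_not_mem_xiLocalChar_eq {ξ ξ' : OneDimAutRepH L} (S₀ : Finset (HeightOneSpectrum (𝓞 ↥(maximalRealSubfield L))))
    (h : ∀ v ∉ S₀, ξ.xiLocalChar v = ξ'.xiLocalChar v) : ξ = ξ' :=
  ext_of_xiLocalChar_eq_of_not_mem S₀ h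

end OneDimAutRepH

end Literature.NumberTheory.Rogawski1990

end
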